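import Summits.CriticalPhenomena.CardyFormulaZ2.Theorems.CardyBoundaryCoulombGasHalfPlaneMarkDensityLawPosDensityPositivityOf

/-!
# `HalfPlaneMarkDensityLaw` (crux stmt-CriticalPhenomena-5661), line `Sketch`, cycle 5 (near-end positivity):
# glue N9' — counting (N3) + decoupling (N8) + below-one give `n · P[NE_n(a,b,c,y)] ≥ c₁ > 0` eventually

Fix `a < b < c < y`.  `Window.stub_eventually_le_one_sub` at `(a,b,c,y)` gives `c₁' > 0` with
`P[A_n ↔ [⌊cn⌋,⌊yn⌋]×{0} in H] ≤ 1 − c₁'` eventually; N3 gives `c₀ > 0` with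
`n · P[NR(⌊bn⌋; ⌊cn⌋, ⌊yn⌋; ⌊an⌋)] ≥ c₀` eventually.  For large `n` apply N8 with `k = ⌊bn⌋`,
`alo = ⌊an⌋`, `clo = ⌊cn⌋`, `chi = ⌊yn⌋`, `q = 1 − c₁'`: the escape crossing
`{[⌊an⌋,⌊bn⌋)×{0} ↔ [⌊cn⌋,⌊yn⌋]×{0} in H}` is contained in `{A_n ↔ [⌊cn⌋,⌊yn⌋]×{0} in H}`
(`openCrossing_mono`, `[⌊an⌋,⌊bn⌋)×{0} ⊆ A_n`), so it has probability `≤ 1 − c₁'`.  Hence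
`c₁' · P[NR] ≤ P[firstHit H ([⌊cn⌋,⌊yn⌋]×{0}) ⌊an⌋ ⌊bn⌋]` and
`n · P[firstHit …] ≥ c₁' · (n · P[NR]) ≥ c₁' c₀ > 0`.
-/

noncomputable section

namespace Summit.CriticalPhenomena.CardyFormulaZ2.Cruxes.HalfPlaneMarkDensityLaw.SketchLine

open Literature.Probability.Percolation Literature.Probability.LatticeModels
open MeasureTheory Filter Set SimpleGraph
open scoped Topology
open Summit.CriticalPhenomena.CardyFormulaZ2.Theorems.HalfPlaneMarkDensityLaw.Negative

namespace NearEndPos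

/-- STUB N9' (glue): N3, N8 and `Window.stub_eventually_le_one_sub` give N9. [folklore] -/
theorem stub_nearEndDensityPositivity_of :
    (∀ (a b c y : ℝ), a < b → b < c → c < y → ∃ c₀ : ℝ, 0 < c₀ ∧ ∀ᶠ n : ℕ in atTop,
      c₀ ≤ (n : ℝ) * μ.real {ω : BondConfig (Site 2) | (∃ r : ℤ, ⌊c * n⌋ ≤ r ∧ r ≤ ⌊y * n⌋ ∧ ω ∈ openConnIn halfPlane (bpt (⌊b * n⌋)) (bpt r)) ∧ ∀ s : ℤ, ⌊a * n⌋ ≤ s → s < ⌊b * n⌋ → ω ∉ openConnIn halfPlane (bpt (⌊b * n⌋)) (bpt s)}) →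
    (∀ (k alo clo chi : ℤ) (q : ℝ), alo ≤ k → k < clo → clo ≤ chi →
      μ.real (openCrossing halfPlane (rowIco alo k) (rowIcc clo chi)) ≤ q →
      (1 - q) * μ.real {ω : BondConfig (Site 2) | (∃ r : ℤ, clo ≤ r ∧ r ≤ chi ∧ ω ∈ openConnIn halfPlane (bpt (k)) (bpt r)) ∧ ∀ s : ℤ, alo ≤ s → s < k → ω ∉ openConnIn halfPlane (bpt (k)) (bpt s)} ≤
        μ.real (firstHit halfPlane (rowIcc clo chi) alo k)) →
    ∀ (a b c y : ℝ), a < b → b < c → c < y → ∃ c₁ : ℝ, 0 < c₁ ∧ ∀ᶠ n : ℕ in atTop,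
      c₁ ≤ (n : ℝ) * μ.real (firstHit halfPlane (rowIcc ⌊c * n⌋ ⌊y * n⌋) ⌊a * n⌋ ⌊b * n⌋) := by
  intro hN3 hN8 a b c y hab hbc hcy
  obtain ⟨c₁, hc₁, hW⟩ := Window.stub_eventually_le_one_sub a b c y hab hbc hcy
  obtain ⟨c₀, hc₀, hN⟩ := hN3 a b c y hab hbc hcy
  refine ⟨c₁ * c₀, mul_pos hc₁ hc₀, ?_⟩
  filter_upwards [hW, hN, Window.eventually_floor_add_two_le hbc, Window.eventually_floor_add_two_le hcy]
    with n hWn hNn e1 e2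
  -- the four lattice marks at scale `n`
  have halok : ⌊a * (n : ℝ)⌋ ≤ ⌊b * (n : ℝ)⌋ :=
    Int.floor_le_floor (mul_le_mul_of_nonneg_right hab.le (Nat.cast_nonneg n))
  have hkclo : ⌊b * (n : ℝ)⌋ < ⌊c * (n : ℝ)⌋ := by omega
  have hclochi : ⌊c * (n : ℝ)⌋ ≤ ⌊y * (n : ℝ)⌋ := by omega
  -- the escape crossing `[⌊an⌋,⌊bn⌋)×{0} ↔ [⌊cn⌋,⌊yn⌋]×{0}` is contained in `{A_n ↔ [⌊cn⌋,⌊yn⌋]×{0}}`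
  have hesc : μ.real (openCrossing halfPlane (rowIco ⌊a * (n : ℝ)⌋ ⌊b * (n : ℝ)⌋)
      (rowIcc ⌊c * (n : ℝ)⌋ ⌊y * (n : ℝ)⌋)) ≤ 1 - c₁ := by
    refine le_trans (measureReal_mono ?_ (measure_ne_top _ _)) hWn
    refine openCrossing_mono subset_rfl ?_ subset_rfl
    intro v hv
    simp only [rowIco, arcA, Set.mem_setOf_eq] at hv ⊢
    omega
  -- decoupling (N8) with `q = 1 − c₁`
  have h8 := hN8 ⌊b * (n : ℝ)⌋ ⌊a * (n : ℝ)⌋ ⌊c * (n : ℝ)⌋ ⌊y * (n : ℝ)⌋ (1 - c₁) halok hkclo hclochi hesc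
  rw [sub_sub_cancel] at h8
  -- multiply by `n ≥ 0` and use the counting bound (N3)
  have hn0 : (0 : ℝ) ≤ n := Nat.cast_nonneg n
  have h8n := mul_le_mul_of_nonneg_left h8 hn0
  have hNc := mul_le_mul_of_nonneg_left hNn hc₁.le
  linarith
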